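import Summits.Ventures.Crystal3D.Theorems.StickyWulffConstantTextureBuildHealLabelled
import Literature.MathematicalPhysics.StatisticalMechanics.LennardJonesClusters
import HarnessLib

/-!
# TB-1 brick L-HEAL, window form: a perfect FRAME around a ball makes its interior healable to a PERFECT core, losing only off-lattice balls
# (lane T, crux `TextureLiminfV5`, stmt-Ventures-23912; blueprint HOME/wulff-p2/g23/TB-COVER-BLUEPRINT-g23.md step S3 «selection»)

HONEST FRAMING. Venture `Summits/Ventures/Crystal3D` (cell `crystal3d-full`), route `route-Ventures-StickyWulffConstant`, helper `--supports` the
law-v5 crux `TextureLiminfV5` (stmt-Ventures-23912).  Pure finite combinatorics over '…TextureBuildHealLabelled' (census-free, standard axioms).  Nothing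
about any cover or texture is claimed; F-C1 not moved.

The healed binder `CoverH` (v8.24 `stub_TB_cover`) needs, near every wall piece, a healed packing in which the grain's plates are COMPLETE.  This file turns
the collar hypotheses of `contactDeficiency_heal_le` / `exists_healed_packing` into ONE geometric hypothesis a constructor can supply from the resolution:

* `finite_stacking_inter_closedBall` — a moved Barlow stacking meets every closed ball in finitely many sites;
* **`exists_healed_window`** — `S` a moved Barlow stacking, `x` a unit packing, `c` a centre, `R` real.  If the FRAME `R < dist · c ≤ R + 3` is PERFECT
  (every `S`-site there is a ball; every ball there is an `S`-site all of whose twelve `S`-neighbours are balls), then there is a unit packing `x'` with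
  `6N' − b(x') ≤ 6N − b(x)` which (i) keeps every ball farther than `R + 1` from `c`, (ii) adds only `S`-sites within `R + 1` of `c`, (iii) has EVERY
  `S`-site within `R` of `c` occupied and (iv) every ball within `R` of `c` on `S` (a perfect core: complete plates), and (v) loses at most the OFF-LATTICE
  balls of `x`: `N ≤ N' + #{i | x i ∉ S}`.
Construction: `B` = the `1`-neighbourhood of the BAD points of the core (balls within `R` that are off `S` or have a vacant `S`-neighbour; vacant `S`-sites
within `R`), `V` = all `S`-sites in `B`; the frame hypothesis makes the collar of `B` clean and solid.
-/

noncomputable section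

namespace Summit.Ventures.Crystal3D.Theorems

open Finset Summit.Ventures.Crystal3D
open Literature.MathematicalPhysics.StatisticalMechanics (IsHaggSeq contactDeficiency card_le_of_separated_of_dist_le)
open Summit.Ventures.Crystal3D.Cruxes.TextureLiminf.TexShadow (E3 stacking one_le_dist_of_mem_stacking)

/-- A moved Barlow stacking meets a closed ball in finitely many sites. -/
theorem finite_stacking_inter_closedBall {L : E3 ≃ₗᵢ[ℝ] E3} {s : E3} {σ : ℤ → ℤ} (hσ : IsHaggSeq σ) (c : E3) (r : ℝ) :
    (stacking L s σ ∩ Metric.closedBall c r).Finite := by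
  classical
  by_contra hinf
  rw [Set.not_finite] at hinf
  rcases lt_or_ge r 0 with hr | hr
  · obtain ⟨t, ht, hcard⟩ := hinf.exists_subset_card_eq 1
    obtain ⟨p, hp⟩ := Finset.card_pos.1 (by rw [hcard]; exact Nat.one_pos)
    have := (ht (Finset.mem_coe.2 hp)).2
    rw [Metric.mem_closedBall] at this
    linarith [dist_nonneg (x := p) (y := c)]
  · -- a finite subset with too many points contradicts the packing bound
    set M : ℕ := ⌈((2 : ℝ) * r / 1 + 1) ^ 3⌉₊ + 1 with hM
    obtain ⟨t, ht, hcard⟩ := hinf.exists_subset_card_eq M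
    have hsep : ∀ p ∈ t, ∀ q ∈ t, p ≠ q → (1 : ℝ) ≤ dist p q := fun p hp q hq hpq =>
      one_le_dist_of_mem_stacking hσ (ht (Finset.mem_coe.2 hp)).1 (ht (Finset.mem_coe.2 hq)).1 hpq
    have hin : ∀ p ∈ t, dist p c ≤ r := fun p hp => Metric.mem_closedBall.1 (ht (Finset.mem_coe.2 hp)).2
    have hbound := card_le_of_separated_of_dist_le t c one_pos hr hin hsep
    rw [finrank_euclideanSpace_fin] at hbound
    have hM' : ((2 : ℝ) * r / 1 + 1) ^ 3 < M := by
      rw [hM]; push_cast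
      exact lt_of_le_of_lt (Nat.le_ceil _) (by linarith)
    rw [hcard] at hbound
    linarith

section Window

variable {N : ℕ} {x : Fin N → E3} {L : E3 ≃ₗᵢ[ℝ] E3} {s : E3} {σ : ℤ → ℤ}

open scoped Classical in
/-- **HEALING A WINDOW WITH A PERFECT FRAME.**  See the module docstring. -/
theorem exists_healed_window (hx : IsUnitPacking x) (hσ : IsHaggSeq σ) (c : E3) {R : ℝ}
    (hframe_occ : ∀ w ∈ stacking L s σ, R < dist w c → dist w c ≤ R + 3 → w ∈ Set.range x)
    (hframe_good : ∀ i, R < dist (x i) c → dist (x i) c ≤ R + 3 →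
      x i ∈ stacking L s σ ∧ ∀ w ∈ stacking L s σ, dist (x i) w = 1 → w ∈ Set.range x) :
    ∃ (N' : ℕ) (x' : Fin N' → E3), IsUnitPacking x' ∧
      6 * (N' : ℝ) - (numContacts x' : ℝ) ≤ 6 * (N : ℝ) - (numContacts x : ℝ) ∧
      (∀ i, R + 1 < dist (x i) c → x i ∈ Set.range x') ∧
      (∀ j, x' j ∈ Set.range x ∨ (x' j ∈ stacking L s σ ∧ dist (x' j) c ≤ R + 1)) ∧
      (∀ w ∈ stacking L s σ, dist w c ≤ R → w ∈ Set.range x') ∧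
      (∀ j, dist (x' j) c ≤ R → x' j ∈ stacking L s σ) ∧
      N ≤ N' + (Finset.univ.filter fun i => x i ∉ stacking L s σ).card := by
  classical
  set S : Set E3 := stacking L s σ with hSdef
  set X : Finset E3 := Finset.univ.image x with hXdef
  have hmemX : ∀ {a : E3}, a ∈ X ↔ a ∈ Set.range x := fun {a} => by
    rw [hXdef]; exact mem_image_univ_iff_mem_range
  -- good and bad points of the core
  let Good : E3 → Prop := fun a => a ∈ S ∧ ∀ w ∈ S, dist a w = 1 → w ∈ Set.range x
  let Bad : E3 → Prop := fun p => dist p c ≤ R ∧ ((p ∈ Set.range x ∧ ¬ Good p) ∨ (p ∈ S ∧ p ∉ Set.range x))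
  let B : Set E3 := {y | ∃ p, Bad p ∧ dist y p ≤ 1}
  have hBball : ∀ y ∈ B, dist y c ≤ R + 1 := by
    rintro y ⟨p, hp, hyp⟩
    calc dist y c ≤ dist y p + dist p c := dist_triangle _ _ _
      _ ≤ 1 + R := add_le_add hyp hp.1
      _ = R + 1 := add_comm _ _
  have hBadB : ∀ p, Bad p → p ∈ B := fun p hp => ⟨p, hp, by rw [dist_self]; exact zero_le_one⟩
  -- every ball within `R + 3` that is not bad is good; in particular every kept ball near `B`
  have hgood_of_near : ∀ i, x i ∉ B → dist (x i) c ≤ R + 3 → Good (x i) := by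
    intro i hiB hd
    by_cases hR' : dist (x i) c ≤ R
    · by_contra hng
      exact hiB (hBadB _ ⟨hR', Or.inl ⟨⟨i, rfl⟩, hng⟩⟩)
    · push Not at hR'
      exact hframe_good i hR' hd
  -- the new sites
  have hfin := finite_stacking_inter_closedBall (L := L) (s := s) hσ c (R + 1)
  let V : Finset E3 := hfin.toFinset.filter fun v => v ∈ B
  have hVS : ∀ v ∈ V, v ∈ stacking L s σ := fun v hv =>
    ((Set.Finite.mem_toFinset hfin).1 (Finset.mem_filter.1 hv).1).1
  have hVB : ∀ v ∈ V, v ∈ B := fun v hv => (Finset.mem_filter.1 hv).2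
  have hVall : ∀ w ∈ stacking L s σ, w ∈ B → w ∈ V := fun w hw hwB =>
    Finset.mem_filter.2 ⟨(Set.Finite.mem_toFinset hfin).2 ⟨hw, Metric.mem_closedBall.2 (hBball w hwB)⟩, hwB⟩
  -- collar: a kept ball touching `B` is within `R + 3` of `c`, hence good
  have hnear : ∀ i, x i ∉ B → (∃ y, (y ∈ Finset.univ.image x ∨ y ∈ V) ∧ y ∈ B ∧ dist (x i) y ≤ 1) → Good (x i) := by
    rintro i hiB ⟨y, -, hyB, hd⟩
    refine hgood_of_near i hiB ?_
    calc dist (x i) c ≤ dist (x i) y + dist y c := dist_triangle _ _ _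
      _ ≤ 1 + (R + 1) := add_le_add hd (hBball y hyB)
      _ ≤ R + 3 := by linarith
  have hcolS : ∀ i, x i ∉ B → (∃ y, (y ∈ Finset.univ.image x ∨ y ∈ V) ∧ y ∈ B ∧ dist (x i) y ≤ 1) → x i ∈ stacking L s σ :=
    fun i hiB h => (hnear i hiB h).1
  have hcolX : ∀ i, x i ∉ B → (∃ y, (y ∈ Finset.univ.image x ∨ y ∈ V) ∧ y ∈ B ∧ dist (x i) y ≤ 1) →
      ∀ w ∈ stacking L s σ, dist (x i) w = 1 → w ∉ B → w ∈ Finset.univ.image x :=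
    fun i hiB h w hw hdw _ => hmemX.2 ((hnear i hiB h).2 w hw hdw)
  have hcolV : ∀ v ∈ V, ∀ w ∈ stacking L s σ, dist v w = 1 → w ∉ B → w ∈ Finset.univ.image x := by
    intro v hv w hw hdw hwB
    have hwc : dist w c ≤ R + 2 := by
      calc dist w c ≤ dist w v + dist v c := dist_triangle _ _ _
        _ ≤ 1 + (R + 1) := add_le_add (by rw [dist_comm, hdw]) (hBball v (hVB v hv))
        _ = R + 2 := by ring
    by_cases hwR : dist w c ≤ R
    · -- a vacant site within `R` would be bad, hence in `B`
      by_contra hwX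
      exact hwB (hBadB w ⟨hwR, Or.inr ⟨hw, fun h => hwX (hmemX.2 h)⟩⟩)
    · push Not at hwR
      exact hmemX.2 (hframe_occ w hw hwR (by linarith))
  -- heal
  obtain ⟨N', x', hx', himg, hdef, -⟩ := exists_healed_packing hx hσ B V hVS hVB hVall hcolS hcolX hcolV
  have hmem' : ∀ {a : E3}, a ∈ Set.range x' ↔ a ∈ heal (Finset.univ.image x) V B := fun {a} => by
    rw [← himg]; exact mem_image_univ_iff_mem_range.symm
  refine ⟨N', x', hx', hdef, ?_, ?_, ?_, ?_, ?_⟩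
  · -- (i) far balls are kept
    intro i hi
    have hiB : x i ∉ B := fun h => by linarith [hBball _ h]
    exact hmem'.2 ((mem_heal _ _ _).2 (Or.inl ⟨Finset.mem_image_of_mem _ (Finset.mem_univ _), hiB⟩))
  · -- (ii) new balls are window sites
    intro j
    rcases (mem_heal _ _ _).1 (hmem'.1 ⟨j, rfl⟩) with ⟨hX', -⟩ | hV'
    · exact Or.inl (hmemX.1 hX')
    · exact Or.inr ⟨hVS _ hV', hBball _ (hVB _ hV')⟩
  · -- (iii) the core is complete
    intro w hw hwR
    by_cases hwB : w ∈ B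
    · exact hmem'.2 ((mem_heal _ _ _).2 (Or.inr (hVall w hw hwB)))
    · have hwX : w ∈ Set.range x := by
        by_contra hwX
        exact hwB (hBadB w ⟨hwR, Or.inr ⟨hw, hwX⟩⟩)
      exact hmem'.2 ((mem_heal _ _ _).2 (Or.inl ⟨hmemX.2 hwX, hwB⟩))
  · -- (iv) the core is clean
    intro j hj
    rcases (mem_heal _ _ _).1 (hmem'.1 ⟨j, rfl⟩) with ⟨hX', hB'⟩ | hV'
    · obtain ⟨i, hi⟩ := hmemX.1 hX'
      rw [← hi] at hB' hj ⊢
      exact (hgood_of_near i hB' (by linarith)).1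
    · exact hVS _ hV'
  · -- (v) only off-lattice balls are lost
    have hN' : N' = (heal (Finset.univ.image x) V B).card := by
      rw [← himg, card_image_univ_eq x' hx'.injective]
    have hN : N = X.card := (card_image_univ_eq x hx.injective).symm
    -- `heal = kept ∪ V`, disjoint
    have hKV : Disjoint (X.filter fun a => a ∉ B) V := by
      rw [Finset.disjoint_left]
      intro a haK haV
      exact (Finset.mem_filter.1 haK).2 (hVB a haV)
    have hheal : (heal (Finset.univ.image x) V B).card = (X.filter fun a => a ∉ B).card + V.card := by
      unfold heal; rw [Finset.card_union_of_disjoint hKV]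
    -- the lattice balls of `X` inside `B` are sites of `V`
    have hsub : X.filter (fun a => a ∈ B ∧ a ∈ S) ⊆ V := by
      intro a ha
      obtain ⟨-, haB, haS⟩ := Finset.mem_filter.1 ha
      exact hVall a haS haB
    have h1 : (X.filter fun a => a ∉ B).card + (X.filter fun a => a ∈ B).card = X.card := by
      rw [add_comm]; exact Finset.card_filter_add_card_filter_not (fun a => a ∈ B)
    have h2 : (X.filter fun a => a ∈ B).card =
        (X.filter fun a => a ∈ B ∧ a ∈ S).card + (X.filter fun a => a ∈ B ∧ a ∉ S).card := by
      rw [← Finset.card_union_of_disjoint]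
      · congr 1
        ext a
        simp only [Finset.mem_filter, Finset.mem_union]
        tauto
      · rw [Finset.disjoint_left]
        intro a ha ha'
        exact (Finset.mem_filter.1 ha').2.2 (Finset.mem_filter.1 ha).2.2
    have h3 : (X.filter fun a => a ∈ B ∧ a ∉ S).card ≤ (Finset.univ.filter fun i => x i ∉ S).card := by
      have : X.filter (fun a => a ∈ B ∧ a ∉ S) ⊆ (Finset.univ.filter fun i => x i ∉ S).image x := by
        intro a ha
        obtain ⟨haX, -, haS⟩ := Finset.mem_filter.1 ha
        obtain ⟨i, hi⟩ := hmemX.1 haX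
        exact Finset.mem_image.2 ⟨i, Finset.mem_filter.2 ⟨Finset.mem_univ _, by rw [hi]; exact haS⟩, hi⟩
      exact (Finset.card_le_card this).trans Finset.card_image_le
    have h4 := Finset.card_le_card hsub
    omega

end Window

end Summit.Ventures.Crystal3D.Theorems

end
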